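import Mathlib
import HarnessLib
import Summits.Parity.GeneralizedHardyLittlewood.Theorems.LeeYangFibresModelHyperbolicity

/-!
# Helpers for stub `stub_lawOneAnalytic` of line `SketchIdeator1` (model transfer) for crux
# `LeeYangFibres.FibreHyperbolicity` (stmt-Parity-14108)

Generic lemmas (tag `loa_`) consumed by `LeeYangFibresFibreHyperbolicityLawOneAnalytic.lean`, which proves
`APCellAsymptotic → SegmentLawOne` (Alladi's Ω-cell asymptotic in a fixed residue class ⇒ the segment law
for one progression):
* the integer threshold `Y = ⌊N^{1/u}⌋₊ + 1` of the roughness `N^{1/u}`: `N^{1/u} < Y ≤ N^{1/u} + 1`,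
  `2 ≤ Y`, `log N ≤ u log Y ≤ log N + u`, and `N^{1/u} < P⁻(n) ↔ ⌈Y⌉₊ ≤ P⁻(n)` (`loa_thr_iff`, adapted
  from `WindowChainTransport.cell_eq_omegaCell`);
* counting: `#{m ∈ (M₁, M₂] : p m} = #{m ≤ M₂ : p m} - #{m ≤ M₁ : p m}` and `#{m ≤ X : p m} ≤ X`;
* the Alladi–Buchstab densities `I_{i+1} = cellDensity i` (`DensityCalculus`, landed: `calc_continuous`,
  `calc_nonneg`, `calc_pos`): a uniform bound on `[0, u+1]`, a uniform modulus of continuity at `u`, and a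
  positive common lower bound of `I_{i+1}(u)`, `i + 1 < u`, all over `i < u` (finite sums / minima);
* elementary real inequalities: `X |log N - log X| ≤ (1 + L²) N` for `0 < X ≤ LN`,
  `|log X - log N| ≤ |log δ| + |log L|` on `[δN, LN]`, the estimate of `|log X/log Y - u|`, and the purely
  algebraic assembly of the pointwise defect in the two ranges `X ≥ max(X₀, Y)` (`loa_case2`, with its three
  inputs `loa_h2`, `loa_h3_near`/`loa_h3_far`, `loa_h4`) and `X < max(X₀, Y)` (`loa_case1`).

No named facts are used (Mathlib real analysis only).
-/

namespace Summit.Parity.GeneralizedHardyLittlewood.Cruxes.FibreHyperbolicity.ModelTransfer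

open scoped BigOperators Classical
open Finset Polynomial
open Literature.NumberTheory.Sieve
open Summit.Parity.GeneralizedHardyLittlewood.Cruxes.ModelHyperbolicity.WindowChainTransport (cellDensity)
open Summit.Parity.GeneralizedHardyLittlewood.Cruxes.ModelHyperbolicity.WindowChainTransport
  (calc_continuous calc_nonneg calc_pos)

/-! ## Helper lemmas: the integer threshold `Y = ⌊N^{1/u}⌋₊ + 1` (tag `loa_`) -/

/-- `1 ≤ N^{1/u}` for `N ≥ 1`. -/
theorem loa_one_le_z (u : ℕ) {N : ℕ} (hN : 1 ≤ N) : (1 : ℝ) ≤ (N : ℝ) ^ ((1 : ℝ) / u) :=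
  Real.one_le_rpow (by exact_mod_cast hN) (by positivity)

/-- `N^{1/u} < Y` (adapted from the threshold lemmas of `WindowChainTransport.stub_cellLimit`). -/
theorem loa_z_lt_Y (u N : ℕ) :
    (N : ℝ) ^ ((1 : ℝ) / u) < ((⌊(N : ℝ) ^ ((1 : ℝ) / u)⌋₊ + 1 : ℕ) : ℝ) := by
  push_cast
  exact Nat.lt_floor_add_one _

/-- `Y ≤ N^{1/u} + 1`. -/
theorem loa_Y_le (u N : ℕ) :
    (((⌊(N : ℝ) ^ ((1 : ℝ) / u)⌋₊ + 1 : ℕ) : ℝ)) ≤ (N : ℝ) ^ ((1 : ℝ) / u) + 1 := by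
  push_cast
  linarith [Nat.floor_le (show (0 : ℝ) ≤ (N : ℝ) ^ ((1 : ℝ) / u) by positivity)]

/-- `2 ≤ Y` for `N ≥ 1`. -/
theorem loa_two_le_Y (u : ℕ) {N : ℕ} (hN : 1 ≤ N) :
    (2 : ℝ) ≤ ((⌊(N : ℝ) ^ ((1 : ℝ) / u)⌋₊ + 1 : ℕ) : ℝ) := by
  have h1 : 1 ≤ ⌊(N : ℝ) ^ ((1 : ℝ) / u)⌋₊ := (Nat.one_le_floor_iff _).mpr (loa_one_le_z u hN)
  exact_mod_cast (show 2 ≤ ⌊(N : ℝ) ^ ((1 : ℝ) / u)⌋₊ + 1 by omega)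

/-- `log N ≤ u · log Y` for `N ≥ 1`, `u ≠ 0`. -/
theorem loa_log_le {u N : ℕ} (hu : u ≠ 0) (hN : 1 ≤ N) :
    Real.log N ≤ u * Real.log (((⌊(N : ℝ) ^ ((1 : ℝ) / u)⌋₊ + 1 : ℕ) : ℝ)) := by
  have hN0 : (0 : ℝ) < N := by exact_mod_cast hN
  have hu0 : (u : ℝ) ≠ 0 := by exact_mod_cast hu
  have hz : 0 < (N : ℝ) ^ ((1 : ℝ) / u) := Real.rpow_pos_of_pos hN0 _
  have h1 : Real.log N = u * Real.log ((N : ℝ) ^ ((1 : ℝ) / u)) := by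
    rw [Real.log_rpow hN0]
    field_simp
  rw [h1]
  exact mul_le_mul_of_nonneg_left (Real.log_le_log hz (loa_z_lt_Y u N).le) (Nat.cast_nonneg u)

/-- `u · log Y ≤ log N + u` for `N ≥ 1`, `u ≠ 0` (`Y ≤ 2 N^{1/u}` and `log 2 ≤ 1`). -/
theorem loa_log_Y_le {u N : ℕ} (hu : u ≠ 0) (hN : 1 ≤ N) :
    u * Real.log (((⌊(N : ℝ) ^ ((1 : ℝ) / u)⌋₊ + 1 : ℕ) : ℝ)) ≤ Real.log N + u := by
  have hN0 : (0 : ℝ) < N := by exact_mod_cast hN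
  have hz1 := loa_one_le_z u hN
  have hz0 : 0 < (N : ℝ) ^ ((1 : ℝ) / u) := by linarith
  have hY2 : (((⌊(N : ℝ) ^ ((1 : ℝ) / u)⌋₊ + 1 : ℕ) : ℝ)) ≤ 2 * (N : ℝ) ^ ((1 : ℝ) / u) := by
    linarith [loa_Y_le u N]
  have hYpos : (0 : ℝ) < (((⌊(N : ℝ) ^ ((1 : ℝ) / u)⌋₊ + 1 : ℕ) : ℝ)) := by positivity
  have h1 : Real.log (((⌊(N : ℝ) ^ ((1 : ℝ) / u)⌋₊ + 1 : ℕ) : ℝ)) ≤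
      Real.log 2 + 1 / u * Real.log N := by
    have h := Real.log_le_log hYpos hY2
    rwa [Real.log_mul two_ne_zero hz0.ne', Real.log_rpow hN0] at h
  have h2 : Real.log 2 ≤ 1 := by
    linarith [Real.log_le_sub_one_of_pos (show (0 : ℝ) < 2 by norm_num)]
  have hu0 : (0 : ℝ) < u := Nat.cast_pos.mpr (Nat.pos_of_ne_zero hu)
  have h3 : (u : ℝ) * Real.log (((⌊(N : ℝ) ^ ((1 : ℝ) / u)⌋₊ + 1 : ℕ) : ℝ)) ≤
      u * (Real.log 2 + 1 / u * Real.log N) := mul_le_mul_of_nonneg_left h1 hu0.le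
  have h4 : (u : ℝ) * (Real.log 2 + 1 / u * Real.log N) = u * Real.log 2 + Real.log N := by
    field_simp
  have h5 : (u : ℝ) * Real.log 2 ≤ u * 1 := mul_le_mul_of_nonneg_left h2 hu0.le
  linarith

/-- The real threshold is the integer one: `N^{1/u} < P⁻(n) ↔ ⌈Y⌉₊ ≤ P⁻(n)` for `Y = ⌊N^{1/u}⌋₊ + 1`
(adapted from `WindowChainTransport.cell_eq_omegaCell`). -/
theorem loa_thr_iff (u N n : ℕ) :
    (N : ℝ) ^ ((1 : ℝ) / u) < (Nat.minFac n : ℝ) ↔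
      ⌈(((⌊(N : ℝ) ^ ((1 : ℝ) / u)⌋₊ + 1 : ℕ) : ℝ))⌉₊ ≤ Nat.minFac n := by
  rw [Nat.ceil_natCast, Nat.add_one_le_iff, Nat.floor_lt (by positivity)]

/-! ## Helper lemmas: counting -/

/-- `#{m ∈ (M₁, M₂] : p m} = #{m ∈ [1, M₂] : p m} - #{m ∈ [1, M₁] : p m}` for `M₁ ≤ M₂`. -/
theorem loa_count_split (p : ℕ → Prop) [DecidablePred p] {M₁ M₂ : ℕ} (h : M₁ ≤ M₂) :
    ((((Finset.Ioc M₁ M₂).filter p).card : ℕ) : ℝ) =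
      ((((Finset.Icc 1 M₂).filter p).card : ℕ) : ℝ) - ((((Finset.Icc 1 M₁).filter p).card : ℕ) : ℝ) := by
  have hU : Finset.Icc 1 M₂ = Finset.Icc 1 M₁ ∪ Finset.Ioc M₁ M₂ := by
    ext m
    simp only [Finset.mem_union, Finset.mem_Icc, Finset.mem_Ioc]
    omega
  have hD : Disjoint ((Finset.Icc 1 M₁).filter p) ((Finset.Ioc M₁ M₂).filter p) := by
    rw [Finset.disjoint_left]
    intro m h1 h2
    simp only [Finset.mem_filter, Finset.mem_Icc, Finset.mem_Ioc] at h1 h2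
    omega
  rw [hU, Finset.filter_union, Finset.card_union_of_disjoint hD]
  push_cast
  ring

/-- The trivial bound `#{m ∈ [1, X] : p m} ≤ X`. -/
theorem loa_count_le (p : ℕ → Prop) [DecidablePred p] (X : ℕ) :
    ((((Finset.Icc 1 X).filter p).card : ℕ) : ℝ) ≤ X := by
  have h := Finset.card_filter_le (Finset.Icc 1 X) p
  rw [Nat.card_Icc, Nat.add_sub_cancel] at h
  exact_mod_cast h

/-! ## Helper lemmas: the densities (uniform bound, modulus of continuity at `u`, lower bound) -/

/-- A uniform bound `B ≥ 1` for the densities `I_{i+1}`, `i < u`, on `[0, u+1]`. -/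
theorem loa_dens_bound (u : ℕ) :
    ∃ B : ℝ, 1 ≤ B ∧ ∀ i, i < u → ∀ v : ℝ, 0 ≤ v → v ≤ u + 1 → cellDensity i v ≤ B := by
  have hF : Continuous fun v : ℝ => ∑ i ∈ Finset.range u, cellDensity i v :=
    continuous_finsetSum _ fun i _ => calc_continuous i
  obtain ⟨C, hC⟩ := (isCompact_Icc : IsCompact (Set.Icc (0 : ℝ) (u + 1))).exists_bound_of_continuousOn
    hF.continuousOn
  refine ⟨max C 1, le_max_right _ _, fun i hi v hv0 hv1 => ?_⟩
  have h1 : cellDensity i v ≤ ∑ k ∈ Finset.range u, cellDensity k v :=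
    Finset.single_le_sum (f := fun k => cellDensity k v) (fun k _ => calc_nonneg k v)
      (Finset.mem_range.mpr hi)
  have h2 := hC v ⟨hv0, hv1⟩
  rw [Real.norm_eq_abs] at h2
  calc cellDensity i v ≤ _ := h1
    _ ≤ |∑ k ∈ Finset.range u, cellDensity k v| := le_abs_self _
    _ ≤ C := h2
    _ ≤ max C 1 := le_max_left _ _

/-- A uniform modulus of continuity of the densities `I_{i+1}`, `i < u`, at the point `u` (registered
sub-goal of `stub_lawOneAnalytic`, through which this helpers file lands). -/
theorem loa_dens_modulus : ∀ (u : ℕ) (ε₁ : ℝ), 0 < ε₁ → ∃ ρ : ℝ, 0 < ρ ∧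
    ∀ i : ℕ, i < u → ∀ v : ℝ, |v - u| ≤ ρ → |cellDensity i v - cellDensity i u| ≤ ε₁ := by
  intro u ε₁ hε₁
  set G : ℝ → ℝ := fun v => ∑ i ∈ Finset.range u, |cellDensity i v - cellDensity i u| with hG
  have hGc : Continuous G :=
    continuous_finsetSum _ fun i _ => ((calc_continuous i).sub continuous_const).abs
  have hGu : G u = 0 := by simp [hG]
  obtain ⟨δ, hδ, h⟩ := Metric.continuous_iff.mp hGc u ε₁ hε₁
  refine ⟨δ / 2, by positivity, fun i hi v hv => ?_⟩
  have hd : dist v u < δ := by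
    rw [Real.dist_eq]
    linarith
  have h1 := h v hd
  rw [hGu, Real.dist_eq, sub_zero] at h1
  have h2 : |cellDensity i v - cellDensity i u| ≤ G v :=
    Finset.single_le_sum (f := fun k => |cellDensity k v - cellDensity k u|) (fun k _ => abs_nonneg _)
      (Finset.mem_range.mpr hi)
  linarith [le_abs_self (G v)]

/-- A positive common lower bound `c ≤ 1` for the densities `I_{i+1}(u)`, `i + 1 < u` (positivity (C3)). -/
theorem loa_dens_lower {u : ℕ} (hu : 2 ≤ u) :
    ∃ c : ℝ, 0 < c ∧ c ≤ 1 ∧ ∀ i : ℕ, i + 1 < u → c ≤ cellDensity i u := by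
  have hne : (Finset.range (u - 1)).Nonempty := ⟨0, Finset.mem_range.mpr (by omega)⟩
  obtain ⟨i₀, hi₀, hmin⟩ := Finset.exists_min_image (Finset.range (u - 1)) (fun i => cellDensity i u) hne
  have hi₀' : (i₀ : ℝ) + 1 < u := by
    have h := Finset.mem_range.mp hi₀
    exact_mod_cast (show i₀ + 1 < u by omega)
  have hpos : 0 < cellDensity i₀ u := calc_pos i₀ u hi₀'
  refine ⟨min 1 (cellDensity i₀ u), lt_min one_pos hpos, min_le_left _ _, fun i hi => ?_⟩
  exact (min_le_right _ _).trans (hmin i (Finset.mem_range.mpr (by omega)))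

/-! ## Helper lemmas: elementary real inequalities -/

/-- `X |log N - log X| ≤ (1 + L²) N` for `0 < X ≤ L N`. -/
theorem loa_xlog_le {X N L : ℝ} (hX : 0 < X) (hN : 0 < N) (hXL : X ≤ L * N) :
    X * |Real.log N - Real.log X| ≤ (1 + L ^ 2) * N := by
  rcases le_or_gt X N with h | h
  · have h1 : Real.log N - Real.log X = Real.log (N / X) := (Real.log_div hN.ne' hX.ne').symm
    have h2 : Real.log (N / X) ≤ N / X - 1 := Real.log_le_sub_one_of_pos (by positivity)
    have h3 : 0 ≤ Real.log (N / X) := Real.log_nonneg ((one_le_div hX).mpr h)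
    rw [h1, abs_of_nonneg h3]
    have h4 : X * Real.log (N / X) ≤ X * (N / X - 1) := mul_le_mul_of_nonneg_left h2 hX.le
    have h5 : X * (N / X - 1) = N - X := by field_simp
    nlinarith [sq_nonneg L]
  · have h1 : Real.log X - Real.log N = Real.log (X / N) := (Real.log_div hX.ne' hN.ne').symm
    have h2 : Real.log (X / N) ≤ X / N - 1 := Real.log_le_sub_one_of_pos (by positivity)
    have h3 : 0 ≤ Real.log (X / N) := Real.log_nonneg ((one_le_div hN).mpr h.le)
    rw [abs_sub_comm, h1, abs_of_nonneg h3]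
    have hL : X / N ≤ L := by rwa [div_le_iff₀ hN]
    have hL0 : 0 ≤ L := le_trans (by positivity) hL
    have h4 : X * Real.log (X / N) ≤ X * (X / N - 1) := mul_le_mul_of_nonneg_left h2 hX.le
    have h6 : X * (X / N) ≤ (L * N) * L :=
      mul_le_mul hXL hL (by positivity) (by positivity)
    nlinarith

/-- `|log X - log N| ≤ |log δ| + |log L|` for `δ N ≤ X ≤ L N`. -/
theorem loa_logdiff_le {X N δ L : ℝ} (hX : 0 < X) (hN : 0 < N) (hδ : 0 < δ) (h1 : δ * N ≤ X)
    (h2 : X ≤ L * N) : |Real.log X - Real.log N| ≤ |Real.log δ| + |Real.log L| := by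
  have hL : 0 < L := (mul_pos_iff_of_pos_right hN).mp (hX.trans_le h2)
  have e : Real.log X - Real.log N = Real.log (X / N) := (Real.log_div hX.ne' hN.ne').symm
  rw [e]
  have hlo : Real.log δ ≤ Real.log (X / N) := Real.log_le_log hδ (by rwa [le_div_iff₀ hN])
  have hhi : Real.log (X / N) ≤ Real.log L := Real.log_le_log (by positivity) (by rwa [div_le_iff₀ hN])
  rw [abs_le]
  constructor
  · linarith [neg_abs_le (Real.log δ), abs_nonneg (Real.log L)]
  · linarith [le_abs_self (Real.log L), abs_nonneg (Real.log δ)]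

/-- `|log X/log Y - u| ≤ u (D + u)/ℓ` when `|log X - ℓ| ≤ D` and `ℓ ≤ u log Y ≤ ℓ + u`. -/
theorem loa_vdiff {lX LY ℓ u D : ℝ} (hLY : 0 < LY) (hℓ : 0 < ℓ) (hℓY : ℓ ≤ u * LY)
    (hYℓ : u * LY ≤ ℓ + u) (hu : 0 ≤ u) (hD : |lX - ℓ| ≤ D) : |lX / LY - u| ≤ u * (D + u) / ℓ := by
  have hD0 : 0 ≤ D := (abs_nonneg _).trans hD
  have h1 : lX / LY - u = (lX - u * LY) / LY := by field_simp
  rw [h1, abs_div, abs_of_pos hLY, div_le_div_iff₀ hLY hℓ]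
  have h2 : |lX - u * LY| ≤ D + u := by
    calc |lX - u * LY| = |(lX - ℓ) + (ℓ - u * LY)| := by ring_nf
      _ ≤ |lX - ℓ| + |ℓ - u * LY| := abs_add_le _ _
      _ ≤ D + u := add_le_add hD (abs_sub_le_iff.mpr ⟨by linarith, by linarith⟩)
  calc |lX - u * LY| * ℓ ≤ (D + u) * (u * LY) := mul_le_mul h2 hℓY hℓ.le (by positivity)
    _ = u * (D + u) * LY := by ring

/-- Near range `X ≤ δN`: `|X (I(v) - I(u))/log X| ≤ (κ/4) N/ℓ` from the bound `B` on the densities. -/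
theorem loa_h3_near {X δ N B Iv Iu lX ℓ κ u : ℝ} (hX0 : 0 ≤ X) (hXδ : X ≤ δ * N) (hδ0 : 0 ≤ δ)
    (hN : 0 ≤ N) (hIv0 : 0 ≤ Iv) (hIvB : Iv ≤ B) (hIu0 : 0 ≤ Iu) (hIuB : Iu ≤ B) (hlX : 0 < lX)
    (hℓ : 0 < ℓ) (hℓX : ℓ ≤ u * lX) (hδ : δ * B * u ≤ κ / 4) :
    |X * (Iv - Iu) / lX| ≤ κ / 4 * N / ℓ := by
  have hB0 : 0 ≤ B := hIu0.trans hIuB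
  have hd : |Iv - Iu| ≤ B := abs_sub_le_iff.mpr ⟨by linarith, by linarith⟩
  rw [abs_div, abs_mul, abs_of_nonneg hX0, abs_of_pos hlX, div_le_div_iff₀ hlX hℓ]
  calc X * |Iv - Iu| * ℓ ≤ (δ * N) * B * (u * lX) :=
        mul_le_mul (mul_le_mul hXδ hd (abs_nonneg _) (by positivity)) hℓX hℓ.le (by positivity)
    _ = (δ * B * u) * (N * lX) := by ring
    _ ≤ κ / 4 * (N * lX) := mul_le_mul_of_nonneg_right hδ (by positivity)
    _ = κ / 4 * N * lX := by ring

/-- Far range `δN < X ≤ LN`: `|X (I(v) - I(u))/log X| ≤ (κ/4) N/ℓ` from `|I(v) - I(u)| ≤ ε₁`. -/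
theorem loa_h3_far {X N L ε₁ Iv Iu lX ℓ κ u : ℝ} (hX0 : 0 ≤ X) (hXL : X ≤ L * N) (hN : 0 ≤ N)
    (hL : 0 ≤ L) (hd : |Iv - Iu| ≤ ε₁) (hlX : 0 < lX) (hℓ : 0 < ℓ) (hℓX : ℓ ≤ u * lX)
    (hε₁ : ε₁ * L * u ≤ κ / 4) :
    |X * (Iv - Iu) / lX| ≤ κ / 4 * N / ℓ := by
  have hε₁0 : 0 ≤ ε₁ := (abs_nonneg _).trans hd
  rw [abs_div, abs_mul, abs_of_nonneg hX0, abs_of_pos hlX, div_le_div_iff₀ hlX hℓ]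
  calc X * |Iv - Iu| * ℓ ≤ (L * N) * ε₁ * (u * lX) :=
        mul_le_mul (mul_le_mul hXL hd (abs_nonneg _) (by positivity)) hℓX hℓ.le (by positivity)
    _ = (ε₁ * L * u) * (N * lX) := by ring
    _ ≤ κ / 4 * (N * lX) := mul_le_mul_of_nonneg_right hε₁ (by positivity)
    _ = κ / 4 * N * lX := by ring

/-- `|X I(u) (1/log X - 1/ℓ)| ≤ (κ/4) N/ℓ` from `X |ℓ - log X| ≤ (1 + L²) N` and `ℓ` large. -/
theorem loa_h4 {X N L B Iu lX ℓ κ u : ℝ} (hX0 : 0 ≤ X) (hN : 0 ≤ N)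
    (hxl : X * |ℓ - lX| ≤ (1 + L ^ 2) * N) (hIu0 : 0 ≤ Iu) (hIuB : Iu ≤ B) (hlX : 0 < lX)
    (hℓ : 0 < ℓ) (hℓX : ℓ ≤ u * lX) (hu : 0 < u) (hκ : 0 ≤ κ)
    (hℓ2 : 4 * B * (1 + L ^ 2) * u ≤ κ * ℓ) :
    |X * Iu * (1 / lX - 1 / ℓ)| ≤ κ / 4 * N / ℓ := by
  have hB0 : 0 ≤ B := hIu0.trans hIuB
  have hk : 4 * B * (1 + L ^ 2) ≤ κ * lX := by
    refine le_of_mul_le_mul_right (hℓ2.trans ?_) hu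
    calc κ * ℓ ≤ κ * (u * lX) := mul_le_mul_of_nonneg_left hℓX hκ
      _ = κ * lX * u := by ring
  have h1 : X * Iu * (1 / lX - 1 / ℓ) = Iu * (X * (ℓ - lX)) / (lX * ℓ) := by
    rw [div_sub_div _ _ hlX.ne' hℓ.ne', one_mul, mul_one]
    ring
  rw [h1, abs_div, abs_mul, abs_mul, abs_of_nonneg hIu0, abs_of_nonneg hX0,
    abs_of_pos (mul_pos hlX hℓ), div_le_div_iff₀ (mul_pos hlX hℓ) hℓ]
  calc Iu * (X * |ℓ - lX|) * ℓ ≤ B * ((1 + L ^ 2) * N) * ℓ :=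
        mul_le_mul_of_nonneg_right (mul_le_mul hIuB hxl (by positivity) hB0) hℓ.le
    _ = (4 * B * (1 + L ^ 2)) * (N * ℓ / 4) := by ring
    _ ≤ (κ * lX) * (N * ℓ / 4) := mul_le_mul_of_nonneg_right hk (by positivity)
    _ = κ / 4 * N * (lX * ℓ) := by ring

/-- The error of the hypothesis: `ε_AP X/log Y ≤ (κ/2) N/(φ ℓ)`. -/
theorem loa_h2 {X N L εAP LY ℓ κ φ u : ℝ} (hXL : X ≤ L * N) (hN : 0 ≤ N)
    (hL : 0 ≤ L) (hLY : 0 < LY) (hℓ : 0 < ℓ) (hℓY : ℓ ≤ u * LY) (hφ : 0 < φ)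
    (hφL : φ ≤ L) (hε0 : 0 ≤ εAP) (hε : εAP * L ^ 2 * u ≤ κ / 2) :
    εAP * X / LY ≤ κ / 2 * N / (φ * ℓ) := by
  rw [div_le_div_iff₀ hLY (by positivity)]
  calc εAP * X * (φ * ℓ) ≤ εAP * (L * N) * (L * (u * LY)) :=
        mul_le_mul (mul_le_mul_of_nonneg_left hXL hε0) (mul_le_mul hφL hℓY hℓ.le hL)
          (by positivity) (by positivity)
    _ = (εAP * L ^ 2 * u) * (N * LY) := by ring
    _ ≤ κ / 2 * (N * LY) := mul_le_mul_of_nonneg_right hε (by positivity)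
    _ = κ / 2 * N * LY := by ring

/-- Case `X ≥ max(X₀, Y)`: the pointwise defect from the four estimates (pure algebra). -/
theorem loa_case2 {a X Iv Iu lX ℓ φ S N κ e : ℝ} (hφ : 0 < φ) (hℓ : 0 < ℓ) (hlX : 0 < lX)
    (h1 : |a - (X * Iv / lX - S) / φ| ≤ e) (h2 : e ≤ κ / 2 * N / (φ * ℓ))
    (h3 : |X * (Iv - Iu) / lX| ≤ κ / 4 * N / ℓ) (h4 : |X * Iu * (1 / lX - 1 / ℓ)| ≤ κ / 4 * N / ℓ) :
    |a - X * Iu / (φ * ℓ) + S / φ| ≤ κ * N / (φ * ℓ) := by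
  have key : a - X * Iu / (φ * ℓ) + S / φ =
      (a - (X * Iv / lX - S) / φ) + (1 / φ) * (X * (Iv - Iu) / lX + X * Iu * (1 / lX - 1 / ℓ)) := by
    field_simp
    ring
  rw [key]
  have hφ' : 0 < 1 / φ := by positivity
  calc |(a - (X * Iv / lX - S) / φ) + (1 / φ) * (X * (Iv - Iu) / lX + X * Iu * (1 / lX - 1 / ℓ))|
      ≤ |a - (X * Iv / lX - S) / φ| + |(1 / φ) * (X * (Iv - Iu) / lX + X * Iu * (1 / lX - 1 / ℓ))| :=
        abs_add_le _ _
    _ = |a - (X * Iv / lX - S) / φ| + (1 / φ) * |X * (Iv - Iu) / lX + X * Iu * (1 / lX - 1 / ℓ)| := by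
        rw [abs_mul, abs_of_pos hφ']
    _ ≤ e + (1 / φ) * (κ / 4 * N / ℓ + κ / 4 * N / ℓ) :=
        add_le_add h1 (mul_le_mul_of_nonneg_left ((abs_add_le _ _).trans (add_le_add h3 h4)) hφ'.le)
    _ ≤ κ / 2 * N / (φ * ℓ) + (1 / φ) * (κ / 4 * N / ℓ + κ / 4 * N / ℓ) := by linarith
    _ = κ * N / (φ * ℓ) := by
        field_simp
        ring

/-- Case `X < max(X₀, Y)`: the pointwise defect from the trivial bound (pure algebra). -/
theorem loa_case1 {a X₁ Iu B ℓ φ S L N κ x u : ℝ} (hφ : 0 < φ) (hℓ : 0 < ℓ) (hφL : φ ≤ L)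
    (ha0 : 0 ≤ a) (haX : a ≤ X₁) (hx0 : 0 ≤ x) (hxX : x ≤ X₁) (hIu0 : 0 ≤ Iu) (hIuB : Iu ≤ B)
    (hS0 : 0 ≤ S) (hS : S ≤ X₁ * u / ℓ) (hC : X₁ * (L * ℓ + B + u) ≤ κ * N) :
    |a - x * Iu / (φ * ℓ) + S / φ| ≤ κ * N / (φ * ℓ) := by
  have hX₁ : 0 ≤ X₁ := ha0.trans haX
  have hB0 : 0 ≤ B := hIu0.trans hIuB
  have hφℓ : 0 < φ * ℓ := mul_pos hφ hℓ
  have p1 : a ≤ X₁ * (L * ℓ) / (φ * ℓ) := by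
    rw [le_div_iff₀ hφℓ]
    have h1 : a * (φ * ℓ) ≤ X₁ * (φ * ℓ) := mul_le_mul_of_nonneg_right haX hφℓ.le
    have h2 : X₁ * (φ * ℓ) ≤ X₁ * (L * ℓ) :=
      mul_le_mul_of_nonneg_left (mul_le_mul_of_nonneg_right hφL hℓ.le) hX₁
    linarith
  have p2 : x * Iu / (φ * ℓ) ≤ X₁ * B / (φ * ℓ) :=
    div_le_div_of_nonneg_right (mul_le_mul hxX hIuB hIu0 hX₁) hφℓ.le
  have p2' : 0 ≤ x * Iu / (φ * ℓ) := by positivity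
  have p3 : S / φ ≤ X₁ * u / (φ * ℓ) := by
    have h1 : S / φ ≤ (X₁ * u / ℓ) / φ := div_le_div_of_nonneg_right hS hφ.le
    have h2 : (X₁ * u / ℓ) / φ = X₁ * u / (φ * ℓ) := by
      rw [div_div, mul_comm ℓ φ]
    linarith
  have p3' : 0 ≤ S / φ := by positivity
  have hsum : X₁ * (L * ℓ) / (φ * ℓ) + X₁ * B / (φ * ℓ) + X₁ * u / (φ * ℓ) =
      X₁ * (L * ℓ + B + u) / (φ * ℓ) := by
    rw [← add_div, ← add_div]
    ring
  have htot : X₁ * (L * ℓ + B + u) / (φ * ℓ) ≤ κ * N / (φ * ℓ) :=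
    div_le_div_of_nonneg_right hC hφℓ.le
  rw [abs_le]
  constructor
  · linarith
  · linarith

end Summit.Parity.GeneralizedHardyLittlewood.Cruxes.FibreHyperbolicity.ModelTransfer
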